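import Summits.SmoothPoincare4.SmoothPoincare4.Theses.ConvexBisection
import Literature.Geometry.Symplectic.PlanarContactBoundary
import Literature.Topology.FourManifolds.Isotopy
import Literature.Geometry.Symplectic.GirouxContactPath
import Mathlib.Geometry.Manifold.LocalDiffeomorph

/-!
# Stub `stub_girouxGray` of line `modp-braid-orbits` (reshape r5) for crux
`ConvexBisection.AcyclicBisectionExists` (item stmt-SmoothPoincare4-10508, route route-SmoothPoincare4-ConvexBisection)

GIROUX UNIQUENESS + GRAY STABILITY.  Two plane fields `ξ = ker α`, `ξ' = ker α'` on a closed
3-manifold `N` that are supported by the SAME embedded open book `ob : OpenBook N`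
(`OpenBook.IsGirouxForm`: `α ∧ dα ≠ 0`, `dα > 0` on the `dθ`-co-oriented pages, `α > 0` on the
binding oriented as the boundary of the pages, everything read in the orientation `α ∧ dα`
defines) and induce the same orientation (`α ∧ dα` and `α' ∧ dα'` positive on the same frames)
differ by a diffeomorphism `φ₀` isotopic to the identity: `dφ₀(ξ_y) = ξ'_{φ₀ y}`.

## Audit of the registered signature (worker, 2026-08-16)

* TRUE as stated.  With `N` oriented by `α ∧ dα` (the two forms give the same orientation by the
  `iff` hypothesis: two nowhere-vanishing alternating 3-forms on `𝔼 3` are proportional, and the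
  `iff` says the factor is positive), `IsGirouxForm.pages` is exactly "`dα` is a positive area
  form on the pages oriented by (ambient orientation, co-orientation `dθ = proj^* dφ`)" and
  `IsGirouxForm.binding` is exactly "`α > 0` on `B` with the boundary orientation of the pages"
  (page `{θ = 0} = {w₂ = 0, w₁ > 0}` in a tube, co-oriented by `e₂`, outward normal `-e₁`, so the
  boundary direction `b⁺` is the one with `(b⁺, e₁, e₂)` positive — the condition
  `α(b) · (α ∧ dα)(b, e₁, e₂) > 0`, even in `b`).  These are the two conditions of Etnyre 2006,
  Def. 3.2 / Wendl 2020, p. 77, in Etnyre's conventions (`(∂_ψ, ∂_r, ∂_θ)` positive,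
  `α(∂_ψ) > 0`), re-derived here independently of the module docstring of
  `PlanarContactBoundary.lean`.  Hence both `ξ`, `ξ'` are positive contact structures on
  `(N, or_α)` supported by `(B, π) = (ob.binding, ob.proj)`, and Giroux's uniqueness (Etnyre 2006,
  proof of Prop. 3.18 = Prop. 3.5 of the arXiv source: `α_{iR} = α_i + R f(r) dθ`, `f = r²` near
  `B`, then `s α_{1R} + (1 - s) α_{0R}` is contact for `R ≫ 0` — the three regions need exactly:
  `dα_i > 0` on the commonly oriented pages, `α_i(∂_ψ) > 0` near the commonly oriented binding,
  `α_i ∧ dα_i > 0` for the common orientation; the normal form `proj ∘ tube = w/‖w‖` of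
  `OpenBook` supplies Etnyre's coordinates `(ψ, (r, θ))`) gives a smooth path of contact forms,
  and Gray's theorem (Geiges 2008, Thm. 2.2.2) on the closed manifold `N` (compact, `T2`,
  boundaryless model `𝓡 3`) gives an ambient isotopy `ψ_t` with `Tψ_t(ξ) = ξ_t`; `φ₀ = ψ_1`,
  and `t ↦ ψ_{1-t}` is a `SmoothIsotopy` from `φ₀` to `id` through diffeomorphisms (smooth
  embeddings by `isSmoothEmbedding_diffeomorph_holds`), i.e. `Diffeomorph.IsIsotopic φ₀ refl`.
  No connectedness of `N` is needed (componentwise; a component without binding cannot carry a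
  Giroux form — closed pages have no exact area form — and the argument does not even use this).
  Overlapping / repeated tubes in `ob` are harmless (binding components are equal or disjoint as
  sets; one tube per component is used for the cut-off `f`).
* The orientation hypothesis is NECESSARY: the same `ob` (same `proj`) also carries Giroux forms
  of the opposite orientation (Thurston–Winkelnkemper on `-N` with the pages `Σ̄`), whose kernel
  is the mirror contact structure; a diffeomorphism isotopic to the identity preserves
  orientation and cannot carry a positive contact structure to a negative one.
* NOT PROVABLE in this session: the tree has the flow half of Gray (PROVED:
  `Literature.Topology.FourManifolds.exists_ambientIsotopy_of_timeDependent`, the chart-level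
  Pfaffian transport `Literature.Analysis.ODE.apply_linearization_eq_zero`, the discharged
  `inChart_mextDeriv_holds`), but no Gray stability theorem, no Lie derivative / pull-back of
  `MForm`s along isotopies, and no Giroux path lemma; no existing named fact covers either
  (searched `Gray|Moser|Giroux|isotop` over `Literature/Geometry`, `Literature/Topology`).
  The two missing PUBLISHED facts were stated in the tree's vocabulary and relocated by the gate to
  `Literature/Geometry/Symplectic/GirouxContactPath.lean` (`Literature.Geometry.Symplectic.GirouxContactPath`,
  `Literature.Geometry.Symplectic.GrayStability`, p84502); the r5 signature is PROVED from them
  (`stub_girouxGray_of`, the registered r6 stub), which certifies that these two signatures suffice.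
-/

noncomputable section

-- the prescribed namespace `Summit.<P>.<Sub>.…` duplicates `SmoothPoincare4` (P = Sub)
set_option linter.dupNamespace false

open scoped Manifold ContDiff Topology ContinuousMap

namespace Summit.SmoothPoincare4.SmoothPoincare4.Theorems.AcyclicBisectionExists.ModpBraidOrbits

open Literature.Geometry.Symplectic (OpenBook wedge₁₂)

/-- **The end stage of an ambient isotopy is isotopic to the identity**: for an ambient isotopy
`Ψ` of a `C^∞` manifold `N` (`Ψ_0 = id`), the reversed family `t ↦ Ψ_{1-t}` is a smooth isotopy
from `Ψ_1` to `id` through diffeomorphisms, which are smooth embeddings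
(`Literature.Topology.FourManifolds.isSmoothEmbedding_diffeomorph_holds`); hence
`Diffeomorph.IsIsotopic (Ψ.toDiffeomorph 1) (Diffeomorph.refl _ _ _)`. Hirsch, *Differential
Topology* (1976), Ch. 8 §1. [folklore] -/
theorem isIsotopic_toDiffeomorph_one_refl {EN HN : Type*} [NormedAddCommGroup EN]
    [NormedSpace ℝ EN] [TopologicalSpace HN] {J : ModelWithCorners ℝ EN HN}
    {N : Type*} [TopologicalSpace N] [ChartedSpace HN N] [IsManifold J ∞ N]
    (Ψ : Literature.Topology.FourManifolds.AmbientIsotopy J N) :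
    Literature.Topology.FourManifolds.Diffeomorph.IsIsotopic (Ψ.toDiffeomorph 1)
      (Diffeomorph.refl J N ∞) := by
  refine ⟨{ toFun := fun t => Ψ.toFun (1 - t)
            contMDiff := ?_
            isSmoothEmbedding := fun t =>
              Literature.Topology.FourManifolds.isSmoothEmbedding_diffeomorph_holds
                (Ψ.toDiffeomorph (1 - t))
            map_zero := by
              funext y
              rw [sub_zero, Literature.Topology.FourManifolds.AmbientIsotopy.coe_toDiffeomorph]
            map_one := by
              funext y
              rw [sub_self, Ψ.map_zero]
              rfl }⟩
  have h : ContMDiff (𝓘(ℝ, ℝ).prod J) (𝓘(ℝ, ℝ).prod J) ∞ (fun p : ℝ × N => (1 - p.1, p.2)) :=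
    ((contDiff_const.sub contDiff_id).contMDiff.comp contMDiff_fst).prodMk contMDiff_snd
  exact Ψ.contMDiff.comp h

/-- **A diffeomorphism carries a plane field onto another as soon as it does so vectorwise**:
if `v ∈ ξ_y ↔ dφ_y(v) ∈ ξ'_{φ y}` for all `v`, then `dφ_y(ξ_y) = ξ'_{φ y}` — the inclusion `⊇`
uses that the differential of a diffeomorphism is onto
(`Diffeomorph.mfderivToContinuousLinearEquiv`). [folklore] -/
theorem submodule_map_mfderiv_eq_of_iff {EN HN : Type*} [NormedAddCommGroup EN]
    [NormedSpace ℝ EN] [TopologicalSpace HN] {J : ModelWithCorners ℝ EN HN}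
    {N : Type*} [TopologicalSpace N] [ChartedSpace HN N] [IsManifold J ∞ N]
    (φ : N ≃ₘ⟮J, J⟯ N) (ξ ξ' : N → Submodule ℝ EN) (y : N)
    (h : ∀ v : EN, v ∈ ξ y ↔ mfderiv J J φ y v ∈ ξ' (φ y)) :
    (ξ y).map (mfderiv J J φ y).toLinearMap = ξ' (φ y) := by
  ext w
  simp only [Submodule.mem_map, ContinuousLinearMap.coe_coe]
  constructor
  · rintro ⟨v, hv, rfl⟩
    exact (h v).1 hv
  · intro hw
    have hn : (∞ : WithTop ℕ∞) ≠ 0 := by simp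
    obtain ⟨v, hv⟩ := (φ.mfderivToContinuousLinearEquiv hn y).surjective w
    have hv' : mfderiv J J φ y v = w := hv
    exact ⟨v, (h v).2 (hv' ▸ hw), hv'⟩

/-- **The registered stub `stub_girouxGray`, proved from the two published facts**
`GirouxContactPath` (Giroux 2002 / Etnyre 2006, Prop. 3.18: a smooth path of contact forms
between two Giroux forms of one open book with the same orientation) and `GrayStability`
(Gray 1959 / Geiges 2008, Thm. 2.2.2): the ambient isotopy `Ψ` of Gray's theorem along Giroux's
path has `dΨ_1(ker α) = ker α'`, i.e. `dΨ_1(ξ_y) = ξ'_{Ψ_1 y}` (`IsGirouxForm.ker_eq` on both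
sides, `submodule_map_mfderiv_eq_of_iff`), and `φ₀ := Ψ_1` is isotopic to the identity
(`isIsotopic_toDiffeomorph_one_refl`).  This is the registered r6 stub VERBATIM (the r5 statement made
conditional on the two named facts, now `Literature.Geometry.Symplectic.GirouxContactPath` and
`Literature.Geometry.Symplectic.GrayStability`, p84502). [folklore] -/
theorem stub_girouxGray_of :
    Literature.Geometry.Symplectic.GirouxContactPath → Literature.Geometry.Symplectic.GrayStability →
    ∀ (N : Type) [TopologicalSpace N] [T2Space N] [CompactSpace N]
      [ChartedSpace (EuclideanSpace ℝ (Fin 3)) N] [IsManifold (𝓡 3) ∞ N]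
      (ob : Literature.Geometry.Symplectic.OpenBook N)
      (ξ ξ' : N → Submodule ℝ (EuclideanSpace ℝ (Fin 3)))
      (α α' : Literature.Geometry.Kaehler.MForm (𝓡 3) N ℝ 1),
      ob.IsGirouxForm ξ α → ob.IsGirouxForm ξ' α' →
      (∀ y u v w, 0 < Literature.Geometry.Symplectic.wedge₁₂ (α y) (Literature.Geometry.Kaehler.mextDeriv α y) u v w ↔
        0 < Literature.Geometry.Symplectic.wedge₁₂ (α' y) (Literature.Geometry.Kaehler.mextDeriv α' y) u v w) →
      ∃ φ₀ : N ≃ₘ⟮𝓡 3, 𝓡 3⟯ N,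
        Literature.Topology.FourManifolds.Diffeomorph.IsIsotopic φ₀ (Diffeomorph.refl (𝓡 3) N ∞) ∧
        ∀ y, (ξ y).map (mfderiv (𝓡 3) (𝓡 3) φ₀ y).toLinearMap = ξ' (φ₀ y) := by
  intro hGiroux hGray N _ _ _ _ _ ob ξ ξ' α α' hα hα' hor
  obtain ⟨A, hA0, hA1, hAs, hAc⟩ := hGiroux N ob ξ ξ' α α' hα hα' hor
  obtain ⟨Ψ, hΨ⟩ := hGray N A hAs hAc
  refine ⟨Ψ.toDiffeomorph 1, isIsotopic_toDiffeomorph_one_refl Ψ, fun y => ?_⟩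
  refine submodule_map_mfderiv_eq_of_iff (Ψ.toDiffeomorph 1) ξ ξ' y fun v => ?_
  have key := hΨ 1 ⟨zero_le_one, le_rfl⟩ y v
  rw [hA0, hA1] at key
  exact (hα.ker_eq y v).symm.trans (key.trans (hα'.ker_eq _ _))

end Summit.SmoothPoincare4.SmoothPoincare4.Theorems.AcyclicBisectionExists.ModpBraidOrbits

end
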